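import Summits.ResolutionOfSingularities.ResolutionOfSingularities.Theorems.FrobeniusLadderFRationalResolutionSegreConeResolution
import Literature.AlgebraicGeometry.Resolution.BlowupsFlatBaseChange
import Mathlib.AlgebraicGeometry.Morphisms.UnderlyingMap
import HarnessLib

/-!
# Cone programme, Segre family: the blown-up cone is regular, and the Segre cone is regular off its vertex

Support file for crux stmt-ResolutionOfSingularities-15317 (`FrobeniusLadder.FRationalResolution`), line `redirect`,
CONE PROGRAMME. For the Segre ring `SR[a,b] = k[xᵢyⱼ] ⊆ k[x₁,…,x_a,y₁,…,y_b]` with vertex ideal `SM = (xᵢyⱼ)`: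

* `segreCone_isRegular_affineBlowup` — the blowing up `Bl_{SM} Spec SR[a,b]` is a REGULAR scheme: its charts
  `SR[a,b][SM/xᵢyⱼ] ≅ 𝔸^{a+b-1}` are regular rings (`stub_segre_chart_isRegularRing`, p794413) and cover it
  (`affineBlowup.isRegular_of_isRegularRing_blowupAlgebra`);
* `segreCone_mem_regularLocus_of_not_mem` — **the Segre cone is regular off the vertex**: a prime `P` of `SR[a,b]` NOT
  containing some generator `xᵢyⱼ` is a regular point of `Spec SR[a,b]`, because the blowing up is an isomorphism over
  `D(xᵢyⱼ)` (`affineBlowup.isIso_morphismRestrict`, Stacks 02OS) with regular source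
  (regularity descends to the image point along the stalk isomorphism, `mem_regularLocus_iff_of_isIso_morphismRestrict`).
Together with `segreCone_not_isRegularRing` / the vertex files this pins the singular locus of the Segre cone to the vertex
alone (assembled in the sibling package file). [folklore; Kollár 2007 §2.2; StacksProject Tag 02OS; GortzWedhorn2020 (13.19)]
Only Mathlib and the landed tree files above are used; no named published fact.
-/

-- single-problem summit: the doubled namespace component is forced
set_option linter.dupNamespace false

noncomputable section

namespace Summit.ResolutionOfSingularities.ResolutionOfSingularities.Theorems.FRationalResolution

open MvPolynomial AlgebraicGeometry
open Literature.AlgebraicGeometry.Resolution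

section Cones

variable (k : Type) [Field k]

/-- The polynomial ring in two blocks of `a` and `b` variables `xᵢ = X (inl i)`, `yⱼ = X (inr j)`. -/
local notation3 "SP[" a ", " b "]" => MvPolynomial (Fin a ⊕ Fin b) k

/-- The Segre ring `k[xᵢyⱼ] ⊆ k[x, y]` (same term as in `…SegreChartRegular.lean`; the named arguments of
`MvPolynomial.X` only fix the elaboration order). -/
local notation3 "SR[" a ", " b "]" =>
  Algebra.adjoin k (Set.range (fun ij : Fin a × Fin b =>
    (MvPolynomial.X (R := k) (σ := Fin a ⊕ Fin b) (Sum.inl ij.1) *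
      MvPolynomial.X (R := k) (σ := Fin a ⊕ Fin b) (Sum.inr ij.2) : MvPolynomial (Fin a ⊕ Fin b) k)))

/-- The vertex ideal of the Segre cone: spanned by the generators `xᵢyⱼ`. -/
local notation3 "SM[" a ", " b "]" =>
  Ideal.span {v : ↥SR[a, b] | ∃ ij : Fin a × Fin b,
    (v : MvPolynomial (Fin a ⊕ Fin b) k) = MvPolynomial.X (Sum.inl ij.1) * MvPolynomial.X (Sum.inr ij.2)}

/-- The generator `xᵢyⱼ` as an element of the Segre ring `SR[a,b]`. -/
local notation3 "SG[" a ", " b ", " i ", " j "]" =>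
  (⟨MvPolynomial.X (Sum.inl i) * MvPolynomial.X (Sum.inr j), segreChart_X_mul_X_mem k a b i j⟩ : ↥SR[a, b])

/-- **The blown-up Segre cone `Bl_{SM} Spec k[xᵢyⱼ]` is a regular scheme**: the charts `D₊(xᵢyⱼ t) ≅ Spec SR[a,b][SM/xᵢyⱼ]`
at the generating family cover the blowing up and every chart ring is regular (`stub_segre_chart_isRegularRing`), so
`affineBlowup.isRegular_of_isRegularRing_blowupAlgebra` applies. [folklore; GortzWedhorn2020 (13.19); Kollár 2007 §2.2] -/
theorem segreCone_isRegular_affineBlowup (a b : ℕ) : Scheme.IsRegular (affineBlowup SM[a, b]) := by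
  have hI : SM[a, b] = Ideal.span (Set.range (fun ij : Fin a × Fin b => SG[a, b, ij.1, ij.2])) := by
    rw [segreCone_genSet_eq_range k a b]
  exact affineBlowup.isRegular_of_isRegularRing_blowupAlgebra (I := SM[a, b])
    (fun ij : Fin a × Fin b => SG[a, b, ij.1, ij.2]) (fun ij => segreChart_gen_mem_SM k a b ij.1 ij.2) hI.le
    (fun ij => stub_segre_chart_isRegularRing k a b ij.1 ij.2 _ rfl)

/-- **The Segre cone is regular off its vertex.** If a prime `P` of `SR[a,b] = k[xᵢyⱼ]` does not contain the generator
`xᵢyⱼ`, then `P` is a regular point of `Spec SR[a,b]`: the blowing up `π : Bl_{SM} Spec SR[a,b] → Spec SR[a,b]` is an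
isomorphism over `D(xᵢyⱼ)` (`affineBlowup.isIso_morphismRestrict`) and its source is regular
(`segreCone_isRegular_affineBlowup`); a point of the blowing up over `P` exists (isomorphisms are surjective) and is regular,
and regularity passes to `P` along the stalk isomorphism (`mem_regularLocus_iff_of_isIso_morphismRestrict`).
[folklore; StacksProject Tag 02OS] -/
theorem segreCone_mem_regularLocus_of_not_mem (a b : ℕ) (P : Spec (CommRingCat.of ↥SR[a, b])) (i : Fin a) (j : Fin b)
    (hP : SG[a, b, i, j] ∉ P.asIdeal) : P ∈ Scheme.regularLocus (Spec (CommRingCat.of ↥SR[a, b])) := by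
  haveI hiso := affineBlowup.isIso_morphismRestrict (I := SM[a, b]) SG[a, b, i, j] (segreChart_gen_mem_SM k a b i j)
  have hreg := segreCone_isRegular_affineBlowup k a b
  have hPU : P ∈ (PrimeSpectrum.basicOpen SG[a, b, i, j] : (Spec (CommRingCat.of ↥SR[a, b])).Opens) := hP
  -- a point of the blowing up over `P` (the restriction over `D(xᵢyⱼ)` is an isomorphism, hence surjective)
  obtain ⟨y, hy⟩ := (affineBlowup.π SM[a, b] ∣_
    (PrimeSpectrum.basicOpen SG[a, b, i, j] : (Spec (CommRingCat.of ↥SR[a, b])).Opens)).surjective ⟨P, hPU⟩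
  have hx : affineBlowup.π SM[a, b] y.1 = P := by
    rw [← morphismRestrict_base_coe]
    exact congrArg Subtype.val hy
  have hxU : affineBlowup.π SM[a, b] y.1 ∈
      (PrimeSpectrum.basicOpen SG[a, b, i, j] : (Spec (CommRingCat.of ↥SR[a, b])).Opens) := by
    rw [hx]; exact hPU
  have h := (mem_regularLocus_iff_of_isIso_morphismRestrict (affineBlowup.π SM[a, b]) _ y.1 hxU).mp
    ((Scheme.mem_regularLocus y.1).mpr (hreg y.1))
  rwa [hx] at h

end Cones

end Summit.ResolutionOfSingularities.ResolutionOfSingularities.Theorems.FRationalResolution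

end
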